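import Mathlib
import HarnessLib
import Literature.Analysis.FluidPDE.AncientMildCompactnessForced
import Literature.Analysis.FluidPDE.RotatedDSSWindowExtraction
import Summits.NavierStokesRegularity.NavierStokesRegularity.Theses.AngularGalerkinLadder

/-! # «engine» line (candidate skeleton) for crux K3a `LocalCompactness`
(item stmt-NavierStokesRegularity-19856, route `route-NavierStokesRegularity-AngularGalerkinLadder`, card K3)

ns-blowup-lean g11 (prover, 2026-08-27; K3a holder of record since DIRECTOR-NS g6 #13 (2), item claimed).
v2: the skeleton theorem concludes the crux BY NAME (A12 `skeleton.conclusion-mismatch` fix); stubs unchanged. The composition `LocalCompactness_of` derives the item VERBATIM (rev 4, clause (4) =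
per-slice locally uniform convergence) from TWO analytic stubs, around ns-blowup-lit g13's kernel engine
`Literature.Analysis.FluidPDE.exists_oseenMild_limit_of_forced` (KNSS 2009 Lemma 6.1 WITH vanishing forcing,
`AncientMildCompactnessForced.lean`, p479172) and the window extraction
`Literature.Analysis.FluidPDE.exists_subseq_window_tendsto` (`RotatedDSSWindowExtraction.lean`, p477577):

* `stub_forcedOseenMild_remainder` (C2a + C2b of LIT-DOSSIER §60): every window profile `(u, p, d)` with
  defect size `ε` satisfies the FORCED Oseen-mild identity on the past with a remainder
  `G(s,t) = u(t) − e^{(t−s)Δ}u(s) + B¹_s(u,u)(t)` bounded by `ε·K(s,t)` for all `s < t < 0` and by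
  `ε·Φ(t)√(t−s)` for lags `≤ 1`, with `Φ ≥ 0` monotone on `(−∞,0)` and `K`, `Φ` depending on the
  window constants only (gauge fixing in the Type-I class WITH the co-band-limited force + the
  `O(√lag)` heat–Leray estimate of the defect Duhamel term);
* `stub_classical_of_typeI_oseenMild` (KNSS Prop 4.1 smoothing + Fabes–Jones–Rivière pressure +
  a past-slab pressure bound): a continuous, weakly divergence-free, Type-I, UNFORCED Oseen-mild field
  on `(−∞,0) × ℝ³` is a classical Navier–Stokes solution there for a pressure bounded on every past slab.

Everything else is bookkeeping proved here: the Type-I profile `β(τ) = C₀/√(−τ)` and `γ = (sup ε)·Φ`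
are monotone; classical slices are continuous and weakly divergence free; the remainder form makes the
perturbed identity definitional; the Type-I space–time weight passes to pointwise limits; the cutoff to
`0` on `t ≥ 0` keeps the classical system on `(−∞,0)` (`IsClassicalNSSolutionOn` only sees the slices
and the one-sided time derivative within `Iio 0`); subsequences compose. Sorries ONLY in `stub_*`.
WHAT THIS IS NOT: not NS — a plan around typed analytic inputs; nothing about Navier–Stokes is claimed. -/

set_option linter.dupNamespace false

namespace Summit.NavierStokesRegularity.NavierStokesRegularity.Cruxes.LocalCompactness.Engine

open scoped Topology
open Filter Set MeasureTheory Function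
open Summit.NavierStokesRegularity.FluidComputer
open Literature.Analysis Literature.Analysis.FluidPDE

/-- The crux behind a local abbreviation (A12 audit shape). -/
abbrev Goal : Prop := Summit.NavierStokesRegularity.NavierStokesRegularity.Theses.AngularGalerkinLadder.LocalCompactness

/-! ## Stubs (2) -/

/-- stub A (L, analysis; LIT-DOSSIER §60 (C2a)+(C2b)): **window profiles are forced-Oseen-mild with an
`ε`-small remainder.** For window constants `(C₀, cmin, cmax, δ)` there are `Φ : ℝ → ℝ` (monotone and
`≥ 0` on `(−∞,0)`) and `K : ℝ → ℝ → ℝ` such that for every rung `L`, every window profile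
`(u, p, d)` with defect size `ε ≥ 0`, and all `s < t < 0`, `x`:
`‖u t x − e^{(t−s)Δ}(u s) x + oseenDuhamel 1 s u u t x‖ ≤ ε · K s t`, and `≤ ε · Φ t · √(t−s)` when
`t − s ≤ 1` (gauge fixing in the Type-I class with the co-band-limited defect as force, then the heat–Leray
estimate of the defect Duhamel term from `HasDefectBound ε d`). -/
theorem stub_forcedOseenMild_remainder :
    ∀ (C₀ cmin cmax δ : ℝ), ∃ (Φ : ℝ → ℝ) (K : ℝ → ℝ → ℝ), MonotoneOn Φ (Iio 0) ∧ (∀ τ < 0, 0 ≤ Φ τ) ∧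
      ∀ (L : ℕ) (ε c : ℝ) (R : EuclideanSpace ℝ (Fin 3) ≃ₗᵢ[ℝ] EuclideanSpace ℝ (Fin 3))
        (u : ℝ → EuclideanSpace ℝ (Fin 3) → EuclideanSpace ℝ (Fin 3))
        (p : ℝ → EuclideanSpace ℝ (Fin 3) → ℝ)
        (d : ℝ → EuclideanSpace ℝ (Fin 3) → EuclideanSpace ℝ (Fin 3)),
        AngularLadder.IsWindowProfile L C₀ cmin cmax δ ε c R u p d → 0 ≤ ε →
          ∀ s t : ℝ, s < t → t < 0 → ∀ x,
            ‖u t x - UnboundedOperators.heatExtension (u s) (t - s) x + oseenDuhamel 1 s u u t x‖ ≤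
                ε * K s t ∧
              (t - s ≤ 1 →
                ‖u t x - UnboundedOperators.heatExtension (u s) (t - s) x + oseenDuhamel 1 s u u t x‖ ≤
                  ε * Φ t * Real.sqrt (t - s)) := by
  sorry

/-- stub B (M/L; KNSS 2009 Prop 4.1 + Fabes–Jones–Rivière + a past-slab pressure bound): **a continuous,
weakly divergence-free, Type-I, unforced Oseen-mild field on the open past is a classical Navier–Stokes
solution there (`ν = 1`, no force) for a pressure bounded on every past slab `(−∞, t]`, `t < 0`.** -/
theorem stub_classical_of_typeI_oseenMild :
    ∀ (C₀ : ℝ) (W : ℝ → EuclideanSpace ℝ (Fin 3) → EuclideanSpace ℝ (Fin 3)),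
      ContinuousOn (uncurry W) (Iio 0 ×ˢ univ) → (∀ t < 0, IsWeaklyDivFree (W t)) →
        HasTypeIDecay C₀ W →
          (∀ s t : ℝ, s < t → t < 0 → ∀ x,
            W t x = UnboundedOperators.heatExtension (W s) (t - s) x - oseenDuhamel 1 s W W t x) →
            ∃ q : ℝ → EuclideanSpace ℝ (Fin 3) → ℝ,
              IsClassicalNSSolutionOn (Iio 0) 1 0 W q ∧ ∀ t < 0, IsBoundedOn (Iic t) q := by
  sorry

/-! ## Bookkeeping -/

/-- A classical solution stays classical when the velocity is modified OUTSIDE the time set (all clauses see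
only the slices on `S` and the time derivative within `S`). Private copy of the tree's
`IsClassicalNSSolutionOn.congr_velocity` (`NSLerayStrongLocalExistence.lean`), to keep imports light. -/
private theorem congr_velocity' {S : Set ℝ} {ν : ℝ}
    {f u v : ℝ → EuclideanSpace ℝ (Fin 3) → EuclideanSpace ℝ (Fin 3)} {p : ℝ → EuclideanSpace ℝ (Fin 3) → ℝ}
    (h : IsClassicalNSSolutionOn S ν f u p) (huv : ∀ t ∈ S, v t = u t) :
    IsClassicalNSSolutionOn S ν f v p where
  smooth_velocity := h.smooth_velocity.congr fun z hz => by
    change v z.1 z.2 = u z.1 z.2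
    rw [huv z.1 (mem_prod.1 hz).1]
  smooth_pressure := h.smooth_pressure
  momentum t ht x := by
    have h1 : timeDerivWithin S v t x = timeDerivWithin S u t x := by
      simp only [timeDerivWithin]
      exact derivWithin_congr (fun s hs => by rw [huv s hs]) (by rw [huv t ht])
    rw [h1, huv t ht]
    exact h.momentum t ht x
  divFree t ht := by
    rw [huv t ht]
    exact h.divFree t ht

/-- The Type-I time profile `τ ↦ C₀/√(−τ)` is monotone on `(−∞, 0)` for `C₀ ≥ 0`. -/
private theorem monotoneOn_typeI_profile {C₀ : ℝ} (hC : 0 ≤ C₀) :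
    MonotoneOn (fun τ : ℝ => C₀ / Real.sqrt (-τ)) (Iio 0) := by
  intro a ha b hb hab
  have hb0 : 0 < Real.sqrt (-b) := Real.sqrt_pos.2 (by simpa using hb)
  exact div_le_div_of_nonneg_left hC hb0 (Real.sqrt_le_sqrt (by linarith))

/-! ## Composition: the crux BY NAME from the two stubs -/

/-- **K3a from the two stubs.** Extraction of the window parameters (`exists_subseq_window_tendsto`),
then lit g13's forced KNSS Lemma 6.1 (`exists_oseenMild_limit_of_forced`) along that subsequence with
`β(τ) = C₀/√(−τ)`, `γ = (sup ε)·Φ` and the remainders of stub A as the vanishing perturbations, then stub B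
for the classical system and the pressure, the Type-I weight by pointwise limits, and the cutoff on `t ≥ 0`. -/
theorem LocalCompactness_of
    (hA : ∀ (C₀ cmin cmax δ : ℝ), ∃ (Φ : ℝ → ℝ) (K : ℝ → ℝ → ℝ), MonotoneOn Φ (Iio 0) ∧
      (∀ τ < 0, 0 ≤ Φ τ) ∧
      ∀ (L : ℕ) (ε c : ℝ) (R : EuclideanSpace ℝ (Fin 3) ≃ₗᵢ[ℝ] EuclideanSpace ℝ (Fin 3))
        (u : ℝ → EuclideanSpace ℝ (Fin 3) → EuclideanSpace ℝ (Fin 3))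
        (p : ℝ → EuclideanSpace ℝ (Fin 3) → ℝ)
        (d : ℝ → EuclideanSpace ℝ (Fin 3) → EuclideanSpace ℝ (Fin 3)),
        AngularLadder.IsWindowProfile L C₀ cmin cmax δ ε c R u p d → 0 ≤ ε →
          ∀ s t : ℝ, s < t → t < 0 → ∀ x,
            ‖u t x - UnboundedOperators.heatExtension (u s) (t - s) x + oseenDuhamel 1 s u u t x‖ ≤
                ε * K s t ∧
              (t - s ≤ 1 →
                ‖u t x - UnboundedOperators.heatExtension (u s) (t - s) x + oseenDuhamel 1 s u u t x‖ ≤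
                  ε * Φ t * Real.sqrt (t - s)))
    (hB : ∀ (C₀ : ℝ) (W : ℝ → EuclideanSpace ℝ (Fin 3) → EuclideanSpace ℝ (Fin 3)),
      ContinuousOn (uncurry W) (Iio 0 ×ˢ univ) → (∀ t < 0, IsWeaklyDivFree (W t)) →
        HasTypeIDecay C₀ W →
          (∀ s t : ℝ, s < t → t < 0 → ∀ x,
            W t x = UnboundedOperators.heatExtension (W s) (t - s) x - oseenDuhamel 1 s W W t x) →
            ∃ q : ℝ → EuclideanSpace ℝ (Fin 3) → ℝ,
              IsClassicalNSSolutionOn (Iio 0) 1 0 W q ∧ ∀ t < 0, IsBoundedOn (Iic t) q) :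
    Goal := by
  intro C₀ cmin cmax δ L ε c R u p d hseq
  obtain ⟨hcmin, hδ, hε, hW⟩ := hseq
  -- window data
  have hcmem : ∀ n, c n ∈ Icc cmin cmax := fun n => ⟨(hW n).2.1, (hW n).2.2.1⟩
  have hprof : ∀ n, AngularLadder.IsRungProfile (L n) C₀ (c n) (R n) (u n) (p n) (d n) :=
    fun n => (hW n).1
  have hcl : ∀ n, IsClassicalNSSolutionOn (Iio 0) 1 (d n) (u n) (p n) := fun n => (hprof n).classical
  have hTI : ∀ n, HasTypeIDecay C₀ (u n) := fun n => (hprof n).hasTypeIDecay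
  have hdef : ∀ n, AngularLadder.HasDefectBound (ε n) (d n) := fun n => (hW n).2.2.2.2
  -- the constants are nonnegative (the spaces are inhabited)
  have hC₀ : 0 ≤ C₀ := by
    have h1 := (norm_nonneg _).trans (hTI 0 (-1) (by norm_num) 0)
    simpa using h1
  have hε0 : ∀ n, 0 ≤ ε n := fun n => by
    have h1 := (norm_nonneg _).trans (hdef n (-1) (by norm_num) 0)
    have h2 : (0 : ℝ) < (‖(0 : EuclideanSpace ℝ (Fin 3))‖ + Real.sqrt (-(-1 : ℝ))) ^ 3 := by simp
    exact (div_nonneg_iff.1 h1).elim (fun h => h.1) fun h => absurd h.2 (not_le.2 h2)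
  -- a uniform bound `M` for the defect sizes (`ε → 0`)
  obtain ⟨M, hM⟩ : ∃ M : ℝ, ∀ n, ε n ≤ M := by
    obtain ⟨b, hb⟩ := hε.bddAbove_range
    exact ⟨b, fun n => hb ⟨n, rfl⟩⟩
  have hM0 : 0 ≤ M := (hε0 0).trans (hM 0)
  -- stub A's profile
  obtain ⟨Φ, K, hΦmono, hΦ0, hrem⟩ := hA C₀ cmin cmax δ
  -- Step 1: extract the window parameters
  obtain ⟨φ₁, c', R', hφ₁, -, hc1, hR1⟩ := exists_subseq_window_tendsto hcmem R
  -- Step 2: the forced KNSS engine along `φ₁`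
  have key := exists_oseenMild_limit_of_forced (E := EuclideanSpace ℝ (Fin 3))
    (A := fun k : ℕ => -((k : ℝ) + 1)) (w := fun k => u (φ₁ k))
    (G := fun k s t x => u (φ₁ k) t x - UnboundedOperators.heatExtension (u (φ₁ k) s) (t - s) x +
      oseenDuhamel 1 s (u (φ₁ k)) (u (φ₁ k)) t x)
    (β := fun τ => C₀ / Real.sqrt (-τ)) (γ := fun τ => M * Φ τ)
    (by
      refine tendsto_atTop_atBot.2 fun b => ⟨Nat.ceil (-b), fun k hk => ?_⟩
      have h1 : -b ≤ (Nat.ceil (-b) : ℝ) := Nat.le_ceil _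
      have h2 : (Nat.ceil (-b) : ℝ) ≤ k := by exact_mod_cast hk
      show -((k : ℝ) + 1) ≤ b
      linarith)
    (monotoneOn_typeI_profile hC₀)
    (fun a ha b hb hab => mul_le_mul_of_nonneg_left (hΦmono ha hb hab) hM0)
    (fun τ hτ => mul_nonneg hM0 (hΦ0 τ hτ))
    (fun k => (hcl (φ₁ k)).smooth_velocity.continuousOn.mono
      (prod_mono (fun t ht => ht.2) Subset.rfl))
    (fun k t ht => VectorCalculus.IsDivFree.isWeaklyDivFree_holds ((hcl (φ₁ k)).divFree t ht.2)
      (contDiff_infty.1 ((hcl (φ₁ k)).contDiff_velocity ht.2) 1))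
    (fun k s t _ _ _ x => by abel)
    (fun k s t _ hst ht hlag x => by
      have h1 := ((hrem (L (φ₁ k)) (ε (φ₁ k)) (c (φ₁ k)) (R (φ₁ k)) (u (φ₁ k)) (p (φ₁ k)) (d (φ₁ k))
        (hW (φ₁ k)) (hε0 (φ₁ k)) s t hst ht x).2 hlag)
      calc _ ≤ ε (φ₁ k) * Φ t * Real.sqrt (t - s) := h1
        _ ≤ M * Φ t * Real.sqrt (t - s) :=
            mul_le_mul_of_nonneg_right (mul_le_mul_of_nonneg_right (hM (φ₁ k)) (hΦ0 t ht))
              (Real.sqrt_nonneg _))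
    (fun s t hst ht x => by
      have hb : ∀ k, ‖u (φ₁ k) t x - UnboundedOperators.heatExtension (u (φ₁ k) s) (t - s) x +
          oseenDuhamel 1 s (u (φ₁ k)) (u (φ₁ k)) t x‖ ≤ ε (φ₁ k) * K s t := fun k =>
        (hrem (L (φ₁ k)) (ε (φ₁ k)) (c (φ₁ k)) (R (φ₁ k)) (u (φ₁ k)) (p (φ₁ k)) (d (φ₁ k))
          (hW (φ₁ k)) (hε0 (φ₁ k)) s t hst ht x).1
      have h0 : Tendsto (fun k => ε (φ₁ k) * K s t) atTop (𝓝 0) := by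
        simpa using (hε.comp hφ₁.tendsto_atTop).mul_const (K s t)
      exact squeeze_zero_norm hb h0)
    (fun k τ hτ x => by
      have h1 := hTI (φ₁ k) τ hτ.2 x
      have hpos : 0 < Real.sqrt (-τ) := Real.sqrt_pos.2 (by linarith [hτ.2])
      exact h1.trans (div_le_div_of_nonneg_left hC₀ hpos (by linarith [norm_nonneg x])))
  obtain ⟨φ₂, W, hφ₂, hWcont, hWdiv, -, hWmild, -, hptw, hloc⟩ := key
  -- Step 3: the Type-I space–time weight passes to the pointwise limit
  have hWTI : HasTypeIDecay C₀ W := fun t ht x =>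
    le_of_tendsto (hptw t ht x).norm (Eventually.of_forall fun j => hTI (φ₁ (φ₂ j)) t ht x)
  -- Step 4: classical system + pressure (stub B)
  obtain ⟨q, hWcl, hq⟩ := hB C₀ W hWcont hWdiv hWTI hWmild
  -- Step 5: cutoff on `t ≥ 0`
  refine ⟨φ₁ ∘ φ₂, c', R', fun t => if t < 0 then W t else 0, q, hφ₁.comp hφ₂,
    hc1.comp hφ₂.tendsto_atTop, fun x => (hR1 x).comp hφ₂.tendsto_atTop, ?_, ?_, ?_, ?_, hq⟩
  · intro t ht
    simpa only [Function.comp_apply, if_pos ht] using hloc t ht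
  · exact congr_velocity' hWcl fun t ht => by simp only [if_pos (show t < 0 from ht)]
  · intro t ht x
    simpa only [if_pos ht] using hWTI t ht x
  · intro t ht
    funext x
    simp only [if_neg (not_lt.2 ht), Pi.zero_apply]

/-- The hypothesis-free skeleton line, concluding the crux BY NAME (carries the stubs' `sorry`s —
decoration, not closure; A12 audit shape: the only theorem of this file whose type is the crux constant). -/
theorem LocalCompactness_skeleton_engine :
    Summit.NavierStokesRegularity.NavierStokesRegularity.Theses.AngularGalerkinLadder.LocalCompactness :=
  LocalCompactness_of stub_forcedOseenMild_remainder stub_classical_of_typeI_oseenMild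

end Summit.NavierStokesRegularity.NavierStokesRegularity.Cruxes.LocalCompactness.Engine
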